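import Summits.BirchSwinnertonDyer.Rank1Residual.X12.O11.RouteUEvenTwin
import Summits.BirchSwinnertonDyer.Rank1Residual.X12.O11.RouteUPrimeMember
import HarnessLib

/-!
# ROUTE U, the EVEN-MEMBER CLASS THEOREM: BSD₇ for every minimal model of `49a1^{(−4n)}`,
# `n ≡ 1, 2 (mod 4)` squarefree, `7 ∤ n` — from Kriz–Li Thm 1.20 + Rem 3.10, Rubin 1983 Thm C,
# Burungale–Flach 2024, Buhler–Gross 1985 (named facts) and TWO Bernoulli-unit certificates

bsd-cm cell (run/shared/lean/pub/bsd-cm/), ROUTE U (Theorem U: BSD(49a1^{(D)}, 7)), seat `bsd-cm-ram`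
(g6). `RouteUPrimeMember` / `RouteUBiprimeMember` are the class theorems for the ODD members
`D = −q`, `−q₁q₂`; this file is their counterpart for the EVEN members `D = −4n` of the O11 class at
`7` (`n = 1, 2, 5, 6, 10, 13, 17, 22`, i.e. `D = −4, −8, −20, −24, −40, −52, −68, −88`, conductor
`N = 49·D²`; all unit-case by the cell's census). Differences from the odd case, all discharged in
the even layers: the character `χ_D` has EVEN conductor `4n` and Kronecker values `[a odd]·(−n/a)`
(`RouteUKroneckerEven.exists_kroneckerFour`, primitive, odd; ψ-layer `RouteUKroneckerPsi`); the
trace form comes from the even twisting formula (`RouteUEvenTraceForm`); `W` is ADDITIVE at `2`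
(hypothesis (3) of Thm 1.20 at `ℓ = 2` holds because `2 ∣ f(ψ) = 7·4n`), so the Heegner prime must be
`r ≡ 7 (mod 8)` (`2` splits in `K'' = ℚ(√−r)`); the descent field is `M = ℚ(√−n)` (`d_M = −4n`) and
the twin field `ℚ(√(nr))` (`d = 4nr`) — Buhler–Gross 1985 Ch. II and Rubin 1983 Thm C are stated for
every quadratic `M` with `7 ∤ d_M` (`RouteUEvenTwin`). Inputs beyond named facts and data: the two
certificates `hcert₁ : ‖B_{1,ω⁴χ_D}‖₇ = 1` (level `7·4n`) and `hcert₂ : ‖B_{1,ωχ_Dχ_{−r}}‖₇ = 1`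
(level `7·4n·r`), and the splitting data `(−r/7) = 1`, `(−r/q) = 1` for the odd primes `q ∣ n`.
Here: **`bsdp_seven_of_twist_cm7_even`**. No 𝒞₇ / full-BSD corollary is drawn: the even members are
additive at `2`, hence not in `𝒞₇` (which asks for good ordinary reduction at `2`); `(W, 2)` is a
CornerF pair at `p = 2`. Instances: the member files `RouteUMemberE4 / E8 / E20 / E24 / E40 / E52 / E68 / E88`
(Heegner primes `r = 31, 47, 199, 47, 199, 103, 47, 271`; certificates evaluated with
`RouteUEulerCriterionNat.jacobiSym_prime_eq_ite_nat`). THEOREMS ONLY; no definitions, no named facts;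
nothing booked.
References: [KrizLi2019] Thm 1.20, Rem 3.10; [Rubin1983] Thm C; [BurungaleFlach2024] Thm 1.1;
[BuhlerGross1985] Ch. II §§7–9; [Mazur1977] III.5; [Cox2013] Lemma 1.14; [Washington1997] §5.1.
-/

noncomputable section

open scoped Classical NumberTheorySymbols
open NumberField WeierstrassCurve DirichletCharacter
open Literature.NumberTheory.EllipticCurves Literature.NumberTheory.EllipticCurves.Rank1Residual
open Literature.NumberTheory.EllipticCurves.KrizLi2019 Literature.NumberTheory.LFunctions
open Literature.NumberTheory.EllipticCurves.ModularForms
open Literature.NumberTheory.EllipticCurves.Rubin1983 (mulTeichmuller thmC_seven_quadraticField)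
open Literature.NumberTheory.QuadraticFields
open Literature.NumberTheory.EllipticCurves.BuhlerGross1985 (firstDescent_seven_oddTwist_of_bernoulli)

namespace Summit.BirchSwinnertonDyer.Rank1Residual.X12.O11.RouteU

/-- **ROUTE U, EVEN-MEMBER CLASS THEOREM.** Let `n ≡ 1, 2 (mod 4)` be squarefree with `7 ∤ n`
(`D = −4n` an even fundamental discriminant), and `r ≡ 7 (mod 8)` a prime `∉ {3, 7}` not dividing `n`
with `(−r/7) = 1` and `(−r/q) = 1` for every odd prime `q ∣ n` (the Heegner field `K'' = ℚ(√−r)`, in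
which `2`, `7` and the primes of `n` split). Assume the two Bernoulli-unit CERTIFICATES `hcert₁`
(`‖B_{1,ω⁴χ_D}‖₇ = 1`, for every Teichmüller `ω` and every character mod `7·4n` with values
`[j odd]·(−n/j)·ω(j)⁴`) and `hcert₂` (`‖B_{1,ωχ_Dχ_{−r}}‖₇ = 1`, likewise at level `7·4n·r`, values
`[j odd]·(−n/j)·(j/r)·ω(j)`). Then for every globally minimal `W/ℚ` with `C • W = 49a1^{(−4n)}`,
`r_an(W) = 1`, every imaginary quadratic `K` with `d_K = −r`, Heegner datum `(D, H, ι, ι₇, P)`,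
Mordell–Weil datum `(crd, g)`, `7 ∤ c` (Manin constant of `D`), and the twin's model data:
**`BSD₇(W)`** — from the named facts Kriz–Li Thm 1.20 / Rem 3.10, Gross–Zagier, Kolyvagin, GZK,
modularity, Rubin 1983 Thm C, Burungale–Flach 2024 and Buhler–Gross 1985 Ch. II, exactly as in the
odd case (`bsdp_seven_of_twist_cm7_prime`), with `ψ = χ_D·ω²` of conductor `7·4n`
(`χ_D = [· odd]·(−n/·)` mod `4n`, primitive, odd), the even trace form, every bad prime `≠ 7` in
`{2} ∪ primes(n)`, the descent over `ℚ(√−n)` and the twin over `ℚ(√(nr))`.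
[cite: KrizLi2019, Thm. 1.20 and Rem. 3.10] [cite: Rubin1983, §0 Thm. C (p. 341)]
[cite: BurungaleFlach2024, Thm 1.1 and Cor. 2] [cite: BuhlerGross1985, Ch. II Prop. (7.2)(2), (8.3)(1), Cor. (9.1) (pp. 16–18)]
[cite: Mazur1977, Ch. III §5, Step 1 (p. 158)] [cite: Miller2011LMS, Thm. 2.5 and (5.1)] -/
theorem bsdp_seven_of_twist_cm7_even {n r : ℕ} [hn : NeZero n] [hr : Fact r.Prime]
    (hn4 : n % 4 = 1 ∨ n % 4 = 2) (hsq : Squarefree n) (h7n : ¬ 7 ∣ n)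
    (hr8 : r % 8 = 7) (hr7 : r ≠ 7) (hr3 : r ≠ 3) (hrn : r.Coprime n)
    (h7split : legendreSym 7 (-(r : ℤ)) = 1)
    (hsplit : ∀ q : ℕ, q.Prime → q ∣ n → q ≠ 2 → J(-(r : ℤ) | q) = 1)
    (hcert₁ : ∀ (ω : DirichletCharacter ℚ_[7] 7), IsTeichmullerCharacter ω →
      ∀ θ : DirichletCharacter ℚ_[7] (7 * (4 * n)),
        (∀ j : ZMod (7 * (4 * n)), θ j =
          ((if Even j.val then (0 : ℤ) else J(-(n : ℤ) | j.val) : ℤ) : ℚ_[7]) * ω (j.val : ZMod 7) ^ 4) →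
        ‖generalizedBernoulli 1 θ‖ = 1)
    (hcert₂ : ∀ (ω : DirichletCharacter ℚ_[7] 7), IsTeichmullerCharacter ω →
      ∀ θ : DirichletCharacter ℚ_[7] (7 * (4 * n) * r),
        (∀ j : ZMod (7 * (4 * n) * r), θ j =
          (((if Even j.val then (0 : ℤ) else J(-(n : ℤ) | j.val)) * J((j.val : ℤ) | r) : ℤ) : ℚ_[7]) *
            ω (j.val : ZMod 7) ^ 1) →
        ‖generalizedBernoulli 1 θ‖ = 1)
    (hKL : KrizLi2019.thm120_padicLogHeegner_unit_of_bernoulli)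
    (hRem : KrizLi2019.rem310_padicLogHeegner_integral)
    (W : WeierstrassCurve ℚ) [W.IsElliptic] [W.IsGloballyMinimal] [NeZero (W.conductorNorm ℤ)]
    (hW : ∃ C : VariableChange ℚ, C • W = cm7.quadraticTwist ((-(4 * (n : ℤ)) : ℤ) : ℚ))
    (K : Type) [Field K] [NumberField K] [NeZero (NumberField.discr K).natAbs]
    (hK : IsImaginaryQuadratic K) (hdK : NumberField.discr K = -(r : ℤ))
    (D : ModularParametrizationData W (W.conductorNorm ℤ))
    (H : HeegnerDatum (W.conductorNorm ℤ) (NumberField.discr K)) (ι : K →+* ℂ) (ιp : K →+* ℚ_[7])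
    (P : (W.baseChange K).toAffine.Point)
    (hGZ : gross_zagier (W.conductorNorm ℤ) W K) (hKo : kolyvagin (W.conductorNorm ℤ) W K)
    (hGZK : rank_eq_analyticRank_of_analyticRank_le_one) (hmod : hasEntireLFunction_rat)
    (hP : WeierstrassCurve.Affine.Point.map ι.toRatAlgHom P = heegnerPointComplex D H)
    (hr1 : W.analyticRank = 1)
    (hLt : (W.quadraticTwist (NumberField.discr K : ℚ)).entireLFunction 1 ≠ 0)
    (Wd : WeierstrassCurve ℚ) [Wd.IsElliptic] [Wd.IsGloballyMinimal] (Cd : VariableChange ℚ)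
    (hWd : Cd • W.quadraticTwist (NumberField.discr K : ℚ) = Wd)
    (hBF : bsdTriple_of_hasCM_of_L_one_ne_zero)
    (hu : padicValRat 7 (Cd.u : ℚ) = 0)
    (hC : Rubin1983.thmC_seven_quadraticField)
    (hBG : BuhlerGross1985.firstDescent_seven_oddTwist_of_bernoulli)
    [Finite (AddCommGroup.torsion (W.baseChange K).toAffine.Point)]
    (crd : (W.baseChange K).toAffine.Point →+ ℤ) (g : (W.baseChange K).toAffine.Point)
    (hg : crd g = 1) (hker : ∀ x, crd x = 0 → IsOfFinAddOrder x)
    (hc7 : ¬ ((7 : ℤ) ∣ D.c)) :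
    BSDp W 7 := by
  -- arithmetic of the parameters
  have hn0 : 0 < n := Nat.pos_of_ne_zero hn.out
  have hr4 : r % 4 = 3 := by omega
  have hr2 : r ≠ 2 := by rintro rfl; norm_num at hr4
  have hr7' : r.Coprime 7 := (Nat.coprime_primes hr.out (by norm_num)).mpr hr7
  have hn7 : (4 * n).Coprime 7 := by
    rw [Nat.coprime_comm, Nat.Prime.coprime_iff_not_dvd (by norm_num)]
    intro hd
    exact h7n ((Nat.Prime.dvd_mul (by norm_num)).mp hd |>.resolve_left (by norm_num))
  have hrn4 : r.Coprime (4 * n) := Nat.Coprime.mul_right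
    (by simpa using Nat.Coprime.pow_right 2 ((Nat.coprime_primes hr.out Nat.prime_two).mpr hr2)) hrn
  have hD0 : (-(4 * (n : ℤ))) ≠ 0 := by omega
  have hnat : (NumberField.discr K).natAbs = r := by rw [hdK]; simp
  -- the characters: `ω` Teichmüller mod 7, `χ = χ_D` mod `4n` (Kronecker values), `ψ = χ·ω²`, `κ' = (·/r)`
  obtain ⟨ω, hω⟩ := exists_isTeichmullerCharacter (p := 7)
  obtain ⟨χ, hχ⟩ := exists_kroneckerFour (-(n : ℤ)) (by omega) (k := 4 * n) (by simp)
  have hχodd : ∀ a : ℕ, Odd a → χ (a : ZMod (4 * n)) = (J(-(n : ℤ) | a) : ℚ_[7]) := fun a ha => by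
    rw [hχ a, if_neg (Nat.not_even_iff_odd.mpr ha)]
  have hχp : χ.IsPrimitive := isPrimitive_kroneckerFour (m := -(n : ℤ)) (by simp) (by omega)
    (by rw [← Int.squarefree_natAbs]; simpa using hsq) hχodd
  have hχo : χ.Odd := kroneckerFour_odd (m := -(n : ℤ)) (by simp) (by omega) (by omega) hχodd
  obtain ⟨κ', hκ'⟩ := exists_legendreCharacter r
  have hκ'J : ∀ a : ℕ, κ' (a : ZMod r) = (jacobiSym (a : ℤ) r : ℚ_[7]) := fun a => by
    rw [hκ', jacobiSym.legendreSym.to_jacobiSym]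
  have hκ'p : κ'.IsPrimitive := conductor_eq_of_prime_of_ne_one κ' (legendreChar_ne_one hr2 κ' hκ')
  set ψ : DirichletCharacter ℚ_[7] (7 * (4 * n)) :=
    changeLevel (dvd_mul_left (4 * n) 7) χ * changeLevel (dvd_mul_right 7 (4 * n)) (ω ^ 2) with hψdef
  -- CM data of `W`
  have hCM : W.HasCM := hasCM_of_twist_cm7 W hD0 hW
  have hKj : cmFieldDiscrOfJ W.j = -7 := cmFieldDiscrOfJ_of_twist_cm7 W hD0 hW
  -- the trace hypothesis
  have hss : ∀ ℓ : ℕ, ℓ.Prime → ¬ (ℓ ∣ 7 * W.conductorNorm ℤ) →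
      ‖((W.LFunction ℓ : ℤ) : ℚ_[7]) -
        (ψ (ℓ : ZMod (7 * (4 * n))) + ψ⁻¹ (ℓ : ZMod (7 * (4 * n))) * ω (ℓ : ZMod 7))‖ < 1 := by
    refine hss_twist_cm7_even W hn4 hsq h7n hW ψ ω hω fun ℓ hℓ hℓN => ?_
    have h7 : ¬ 7 ∣ ℓ := by
      intro h
      have : ℓ = 7 := ((Nat.prime_dvd_prime_iff_eq (by norm_num) hℓ).mp h).symm
      subst this
      exact hℓN (dvd_mul_right 7 _)
    by_cases hc : ℓ.Coprime (4 * n)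
    · rw [hψdef]
      exact psiK_traceIdentity ω χ _ hχ kroneckerVal_trichotomy ℓ h7 hc
    · have hnu : ¬ IsUnit ((ℓ : ℕ) : ZMod (7 * (4 * n))) := by
        rw [ZMod.isUnit_iff_coprime, Nat.coprime_mul_iff_right]
        exact fun h => hc h.2
      rw [MulChar.map_nonunit _ hnu, MulChar.map_nonunit _ hnu, zero_mul, add_zero,
        quadVal_eq_zero χ _ hχ hc, zero_mul]
  -- the Kronecker character of `K = ℚ(√−r)` and the Bernoulli hypothesis
  have hdiv : r ∣ (NumberField.discr K).natAbs := by rw [hnat]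
  set εK := changeLevel hdiv κ' with hεKdef
  have hεK : KrizLi2019.IsKroneckerCharacterOf K εK :=
    isKroneckerCharacterOf_changeLevel_jacobi hK.1 (Or.inr ⟨hdK, hr4⟩) κ' hκ'p hκ'J hdiv
  haveI i1 : NeZero (7 * (4 * n) * (NumberField.discr K).natAbs) := ⟨by rw [hnat]; exact NeZero.ne _⟩
  haveI i2 : NeZero (7 * (4 * n) * (NumberField.discr K).natAbs * 7) :=
    ⟨by rw [hnat]; exact NeZero.ne _⟩
  have hB : ¬ (‖bernoulliOnePrim (bernoulliCharOne ψ εK) *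
      bernoulliOnePrim (bernoulliCharTwo ψ εK ω)‖ ≤ (7 : ℝ)⁻¹) := by
    have e1 : bernoulliOnePrim (bernoulliCharOne ψ εK) = bernoulliOnePrim (bernoulliCharOne ψ κ') := by
      rw [hεKdef, bernoulliCharOne_changeLevel, bernoulliOnePrim_changeLevel]
    have e2 : bernoulliOnePrim (bernoulliCharTwo ψ εK ω) = bernoulliOnePrim (bernoulliCharTwo ψ κ' ω) := by
      rw [hεKdef, bernoulliCharTwo_changeLevel, bernoulliOnePrim_changeLevel]
    rw [e1, e2]
    exact bernoulli_hypothesis_of_certs (p := 7) ψ⁻¹ (psiJ_inv_isPrimitive ω χ hn7 hω hχp)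
      (dvd_mul_right (7 * (4 * n)) r)
      (changeLevel ((dvd_mul_left (4 * n) 7).trans (dvd_mul_right (7 * (4 * n)) r)) χ *
        changeLevel (dvd_mul_left r (7 * (4 * n))) κ' *
        changeLevel ((dvd_mul_right 7 (4 * n)).trans (dvd_mul_right (7 * (4 * n)) r)) ω)
      (thetaTwoJ_isPrimitive ω χ κ' hn7 hr7' hrn4 hω hχp hκ'p) (dvd_mul_right (7 * (4 * n) * r) 7)
      _ (bernoulliCharOne_psiK ω χ κ' hχo) _ (bernoulliCharTwo_psiK ω χ κ' hχo)
      (hcert₁ ω hω _ (psiK_inv_apply ω χ _ hχ kroneckerVal_trichotomy))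
      (hcert₂ ω hω _ (thetaTwoK_apply ω χ _ κ' _ hχ hκ'J))
  haveI : Fact (Nat.Prime 7) := ⟨by norm_num⟩
  -- the descent inputs: no `7`-torsion over `K` (Mazur at the additive `7`), `Ш(W)[7] = 0` (BG85)
  have hiv : ∀ x : (W.baseChange K).toAffine.Point, 7 • x = 0 → x = 0 :=
    noSevenTorsion_baseChange_of_twist_cm7 W hD0 hW K ιp
  have hrk : 1 ≤ W.mordellWeilRank := by rw [(hGZK W (by rw [hr1])).1, hr1]
  have hSW : ∀ [Finite W.sha], ¬ 7 ∣ W.shaOrder := fun {_} =>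
    not_seven_dvd_shaOrder_of_buhlerGross_even χ hBG hn4 hsq h7n hχ hcert₁ W hW hrk
  -- splitting of `7`, `2` and the primes of `n` in `K`; the Heegner hypothesis
  have h7K : ((Ideal.span {(7 : ℤ)}).primesOver (𝓞 K)).ncard = 2 := by
    have := ncard_primesOver_eq_two_of_legendreSym hK (ℓ := 7) (by norm_num) (by rw [hdK]; exact h7split)
    exact_mod_cast this
  have h2K : ((Ideal.span {(2 : ℤ)}).primesOver (𝓞 K)).ncard = 2 :=
    ncard_primesOver_two_eq_two_of_mod_eight hK hdK hr8
  have hqK : ∀ q : ℕ, (hq : q.Prime) → q ∣ n → q ≠ 2 →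
      ((Ideal.span {(q : ℤ)}).primesOver (𝓞 K)).ncard = 2 := fun q hq hqn hq2 => by
    haveI := Fact.mk hq
    exact ncard_primesOver_eq_two_of_legendreSym hK hq2
      (by rw [hdK, jacobiSym.legendreSym.to_jacobiSym]; exact hsplit q hq hqn hq2)
  have hHN : SatisfiesHeegnerHypothesis (W.conductorNorm ℤ) K := by
    intro p hp hpN
    by_cases hp7 : p = 7
    · subst hp7; exact_mod_cast h7K
    · haveI := Fact.mk hp
      rcases eq_two_or_dvd_of_not_hasGoodReductionAtPrime_twist_cm7_even W hW p hp7
          (fun hgood => not_dvd_conductorNorm_of_hasGoodReductionAtPrime W hgood hpN) with h | h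
      · subst h; exact_mod_cast h2K
      · by_cases hp2 : p = 2
        · subst hp2; exact_mod_cast h2K
        · exact hqK p hp h hp2
  -- the twin side by name, the Tamagawa binders, additivity at `7`
  have hWd' : Cd • W.quadraticTwist ((-(r : ℤ) : ℤ) : ℚ) = Wd := by rw [← hWd, hdK]
  have hSd : ∀ [Finite Wd.sha], ¬ 7 ∣ Wd.shaOrder := fun {_} =>
    not_seven_dvd_shaOrder_twin_even χ hC hn4 hsq h7n hr4 hr7 hrn hχ hcert₂ W hW Wd Cd hWd'
  have htw := twin_value_even (r := r) hBF hGZK hmod hn0 W hW Wd Cd hWd' (by rw [← hdK]; exact hLt)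
  have htamW : ¬ 7 ∣ W.tamagawaProduct :=
    not_dvd_tamagawaProduct_of_hasCM W hCM 7 (by norm_num) (by norm_num)
  have htam : padicValNat 7 Wd.tamagawaProduct = padicValNat 7 W.tamagawaProduct := by
    rw [padicValNat.eq_zero_of_not_dvd htamW, padicValNat.eq_zero_of_not_dvd
      (not_dvd_tamagawaProduct_of_hasCM Wd (hasCM_twin_even hn0 hr.out.pos W hW Wd Cd hWd') 7
        (by norm_num) (by norm_num))]
  have hadd : Addv W 7 :=
    X12.addv_of_hasCM_of_cmRamified W 7 hCM (by norm_num) (by rw [CMRamified, hKj]; norm_num)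
  -- the bad primes `ℓ ≠ 7` (`ℓ = 2` or `ℓ ∣ n`) are not coprime to the conductor `7·4n` of `ψ`
  have hbadψ : ∀ {ℓ : ℕ}, ℓ.Prime → (ℓ = 2 ∨ ℓ ∣ n) → ¬ ℓ.Coprime (7 * (4 * n)) := by
    intro ℓ hℓ h hc
    have hc' : ℓ.Coprime (4 * n) := Nat.Coprime.coprime_dvd_right (dvd_mul_left _ 7) hc
    rcases h with h | h
    · subst h
      have := Nat.Coprime.coprime_dvd_right (dvd_mul_right 4 n) hc'
      norm_num at this
    · exact hℓ.one_lt.ne' (Nat.Coprime.eq_one_of_dvd (Nat.Coprime.coprime_dvd_right (dvd_mul_left n 4) hc') h)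
  -- assemble T-U5′
  exact bsdp_of_thm120_of_rem310_of_not_dvd hKL hRem W 7 K D H ι ιp P hGZ hKo hGZK hmod hK hHN hP
    (by norm_num)
    (not_seven_dvd_unitsTorsionOrder hK (by
      rw [hdK]; have := hr.out.five_le_of_ne_two_of_ne_three hr2 hr3; omega))
    hr1 hLt Wd Cd hWd htw htam hu htamW
    hSW hSd
    (7 * (4 * n)) ψ ω (psiJ_isPrimitive ω χ hn7 hω hχp) hω hss
    (psiJ_apply_natCast_ne_one_of_not_coprime ψ (a := 7) (by
      rw [Nat.coprime_mul_iff_right, not_and_or]; exact Or.inl (by norm_num)))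
    (primVal_invMulOmega_psiJ_ne_one ω χ hn7 hω hχp (a := 7) (by
      rw [Nat.coprime_mul_iff_right, not_and_or]; exact Or.inl (by norm_num)))
    (not_hasSplitMultiplicativeReductionAtPrime_of_hasCM W hCM)
    (fun ℓ hℓ h7ℓ hbad => by
      haveI := Fact.mk hℓ
      have h := hbadψ hℓ (eq_two_or_dvd_of_not_hasGoodReductionAtPrime_twist_cm7_even W hW ℓ h7ℓ hbad.1)
      exact ⟨psiJ_apply_natCast_ne_one_of_not_coprime ψ h,
        primVal_invMulOmega_psiJ_ne_one ω χ hn7 hω hχp h⟩)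
    h7K εK hεK hB
    (nsPointCount_seven_of_cmFieldDiscr_eq W hCM hKj)
    crd g hg hker hiv hadd (by norm_num) hc7

end Summit.BirchSwinnertonDyer.Rank1Residual.X12.O11.RouteU

end
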